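import Summits.BirchSwinnertonDyer.Rank1Residual.ManinAdditive.AbsoluteManinValuationBound
import Summits.BirchSwinnertonDyer.Rank1Residual.ManinConstantOne
import Literature.NumberTheory.EllipticCurves.ManinConstantValuationBound
import Literature.NumberTheory.EllipticCurves.ManinConstantEdixhovenAtMostOnce
import HarnessLib

/-!
# Placement edges of candidate E-desc-1 `AbsoluteManinValuationBound` (cell bsd-f2-manin) — PROVED

* `absoluteManinValuationBound_of_maninConstantOne` : Manin's conjecture ⟹ the candidate (`μ = 0`);
* `pastenShimura2024_thm_10_1_of_absoluteManinValuationBound` : the candidate ⟹ the tree's Pasten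
  2024 Thm. 10.1 fact (drop the `S`-hypothesis) — so the candidate sits between print and Manin;
* `absoluteManinValuationBound_clause_of_seven_lt` : at a prime `p > 7` the candidate's clause
  holds with `μ = 1` modulo Edixhoven 1991 Thm. 3 (tree fact
  `edixhoven_padicValInt_maninConstant_le_one`) and modularity (`exists_isNewformOf`, only to
  identify levels with conductors) — the candidate's content is `p ∈ {2, 3, 5, 7}`.
Nothing else is claimed; no fact is introduced.
-/

noncomputable section

open scoped MatrixGroups ModularForm

open CongruenceSubgroup WeierstrassCurve
  Literature.NumberTheory.EllipticCurves.ModularForms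
  Summit.BirchSwinnertonDyer.Rank1Residual.ManinConstant

namespace Summit.BirchSwinnertonDyer.Rank1Residual.ManinAdditive

/-- **Manin ⟹ E-desc-1** (with `μ = 0`): under `ManinConstantOne` every optimal datum has
`|c| = 1`, hence `ord_p(c) = 0`. -/
theorem absoluteManinValuationBound_of_maninConstantOne (hM : ManinConstantOne) :
    AbsoluteManinValuationBound := by
  intro p hp
  refine ⟨0, fun W' _ _ N' _ D' hopt ↦ ?_⟩
  haveI : Fact p.Prime := ⟨hp⟩
  have h1 : |D'.maninConstant| = 1 := hM W' D' hopt
  have hnd : ¬ (p : ℤ) ∣ D'.maninConstant := by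
    intro hdvd
    have h2 : (p : ℤ) ∣ 1 := h1 ▸ (dvd_abs _ _).mpr hdvd
    have h3 : (p : ℤ) = 1 := Int.eq_one_of_dvd_one (by positivity) h2
    exact hp.one_lt.ne' (by exact_mod_cast h3)
  rw [padicValInt.eq_zero_of_not_dvd hnd]

/-- **E-desc-1 ⟹ Pasten 2024 Thm. 10.1** (the tree fact `PastenShimura2024_thm_10_1`): an
absolute bound is in particular a bound for the curves semistable outside any `S`. -/
theorem pastenShimura2024_thm_10_1_of_absoluteManinValuationBound
    (h : AbsoluteManinValuationBound) : PastenShimura2024_thm_10_1 := by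
  intro S p hp
  obtain ⟨μ, hμ⟩ := h p hp
  exact ⟨μ, fun W' _ _ N' _ D' hopt _ ↦ hμ W' D' hopt⟩

/-- **At `p > 7` the clause of E-desc-1 is print** (Edixhoven 1991 Thm. 3, second sentence, by
name, plus modularity to identify the level of a datum with the conductor): `μ = 1` works. -/
theorem absoluteManinValuationBound_clause_of_seven_lt
    (hE1 : edixhoven_padicValInt_maninConstant_le_one) (hnf : exists_isNewformOf)
    {p : ℕ} (hp : p.Prime) (h7 : 7 < p) :
    ∃ μ : ℕ, ∀ (W' : WeierstrassCurve ℚ) [W'.IsElliptic] [W'.IsGloballyMinimal] {N' : ℕ} [NeZero N']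
      (D' : ModularParametrizationData W' N'),
      (∀ z ∈ D'.L.lattice, ∃ w ∈ periodLattice D'.f, z = D'.c * w) →
      padicValInt p D'.maninConstant ≤ μ :=
  ⟨1, fun W' _ _ _ _ D' hopt ↦
    (padicValInt_maninConstant_le_one_of_seven_lt hE1 hnf W' D' hopt hp h7).trans (by norm_num)⟩

end Summit.BirchSwinnertonDyer.Rank1Residual.ManinAdditive

end
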